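import Literature.AlgebraicGeometry.Resolution.BlowupFittingIdealFree
import Literature.RingTheory.FittingIdeal.Support
import Mathlib.RingTheory.Flat.Localization
import Mathlib.Algebra.Module.LocalizedModule.Submodule
import HarnessLib

/-!
# Blowing up a Fitting ideal flattens: the strict transform over a chart is finite locally free
# (Raynaud–Gruson 5.4.2–5.4.3; Stacks 0810/0811, basic case)

Topic: `Literature/AlgebraicGeometry/Resolution`. Globalisation over a chart ring of the local
freeness of `BlowupFittingIdealFree.lean`. Let `B` be a finite `R`-module with `Fit_r(B) = I`,
`a ∈ R`, such that the lower Fitting ideals `Fit_k(B)`, `k < r`, are `a`-power torsion (`B` is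
locally free of rank `r` away from `V(a)`); let `R'` be an `R`-algebra with `I R' = (a)` and `a`
a nonzerodivisor in `R'` — the chart `R[I/a]` of the blowing up of `Spec R` in `I` (Stacks
07Z3 (1), (2)), or any flat `R[I/a]`-algebra. Put `N = R' ⊗_R B` and let
`B' = N/(a-power torsion)` be the strict transform of `B` over the chart (Stacks 080C). Then:

* `fittingIdeal_strictTransform_eq_bot` — `Fit_k(B') = 0` for `k < r` (it dies in `R'[1/a]`,
  where `B'` and `N` agree and `Fit_k(N) = Fit_k(B) R'`, and `a` is a nonzerodivisor);
* `torsionBy_localized_le` — at a prime `𝔭` of `R'`, the `a`-torsion of `N_𝔭` lies in the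
  localisation of the `a`-power torsion of `N`;
* `fittingIdeal_strictTransform_eq_top` — `Fit_r(B') = R'` (at every maximal ideal `𝔪`,
  `B'_𝔪` is a quotient of `N_𝔪/{x ∣ a x = 0}`, generated by `r` elements by Stacks 080Z since
  `Fit_r(N_𝔪) = (a)`; Stacks 07ZC);
* `nonempty_basis_localizedModule_strictTransform` — **`B'` is locally free of rank `r`**:
  `B'_𝔭` is free of rank `r` over `R'_𝔭` for every prime `𝔭` (Stacks 07ZD);
* `flat_strictTransform` — **`B'` is a flat `R'`-module** (and finite): the strict transform of
  `Spec` of a finite `R`-algebra `B` over the chart is finite locally free, in particular flat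
  and of finite presentation over the chart — Raynaud–Gruson flattening (Stacks 081R) for finite
  morphisms over an affine base, chart by chart.

## References

* M. Raynaud, L. Gruson, *Critères de platitude et de projectivité*, Invent. Math. 13 (1971),
  Première partie, 5.4.2, 5.4.3. [RaynaudGruson1971]
* The Stacks Project, Tag 0810 (proof, Steps 8–10), Tag 0811, Tags 080Z, 07ZC, 07ZD, 07ZA.
  [StacksProject]
-/

namespace Literature.AlgebraicGeometry.Resolution

universe u

open TensorProduct Literature.RingTheory.FittingIdeal

variable {R : Type u} [CommRing R] {B : Type u} [AddCommGroup B] [Module R B]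
variable {R' : Type u} [CommRing R'] [Algebra R R']

/-- **The lower Fitting ideals of the strict transform vanish**: with `N = R' ⊗_R B`,
`Fit_k(B)` `a`-power torsion and `a` a nonzerodivisor of `R'`, `Fit_k(N/(a-power torsion)) = 0`.
[cite: StacksProject, Tag 0810 (proof, Step 10)] -/
theorem fittingIdeal_strictTransform_eq_bot [Module.Finite R B] {a : R} {k : ℕ}
    (htors : ∀ x ∈ Module.fittingIdeal R B k, ∃ n : ℕ, a ^ n * x = 0)
    (ha : algebraMap R R' a ∈ nonZeroDivisors R') :
    Module.fittingIdeal R' ((R' ⊗[R] B) ⧸ (⨆ n : ℕ, Submodule.torsionBy R' (R' ⊗[R] B)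
      (algebraMap R R' a ^ n))) k = ⊥ := by
  set b := algebraMap R R' a with hb
  have hN : (Module.fittingIdeal R' (R' ⊗[R] B) k).map
      (algebraMap R' (Localization (Submonoid.powers b))) = ⊥ := by
    rw [Module.fittingIdeal_baseChange, Ideal.map_eq_bot_iff_le_ker]
    intro x hx
    obtain ⟨n, hn⟩ := exists_pow_mul_eq_zero_of_mem_map htors hx
    rw [RingHom.mem_ker, IsLocalization.map_eq_zero_iff (Submonoid.powers b)]
    exact ⟨⟨b ^ n, n, rfl⟩, hn⟩
  rw [eq_bot_iff]
  intro x hx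
  have hx' : algebraMap R' (Localization (Submonoid.powers b)) x = 0 := by
    have hmem := Ideal.mem_map_of_mem (algebraMap R' (Localization (Submonoid.powers b))) hx
    rw [map_fittingIdeal_quotient_powTorsion_eq, hN] at hmem
    exact (Submodule.mem_bot _).mp hmem
  obtain ⟨⟨_, n, rfl⟩, hn⟩ := (IsLocalization.map_eq_zero_iff (Submonoid.powers b) _ _).mp hx'
  exact (Submodule.mem_bot R').mpr ((mem_nonZeroDivisors_iff_right.mp (pow_mem ha n)) _
    (by rwa [mul_comm] at hn))

section Localized

variable {N : Type u} [AddCommGroup N] [Module R' N] (b : R') (P : Ideal R') [P.IsPrime]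
  (L : Type u) [CommRing L] [Algebra R' L] [IsLocalization.AtPrime L P]
  {Nₚ : Type u} [AddCommGroup Nₚ] [Module R' Nₚ] [Module L Nₚ] [IsScalarTower R' L Nₚ]
  (f : N →ₗ[R'] Nₚ) [IsLocalizedModule P.primeCompl f]

/-- At a prime `𝔭`, the `b`-torsion of the localised module `N_𝔭` is contained in the
localisation of the `b`-power torsion of `N` (indeed of the `b`-torsion: if `b (m/s) = 0` then
`u b m = 0` for some `u ∉ 𝔭`, and `m/s = (u m)/(u s)`). [folklore] -/
theorem torsionBy_localized_le :
    Submodule.torsionBy L Nₚ (algebraMap R' L b) ≤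
      (⨆ n : ℕ, Submodule.torsionBy R' N (b ^ n)).localized' L P.primeCompl f := by
  intro x hx
  rw [Submodule.mem_torsionBy_iff] at hx
  obtain ⟨⟨m, s⟩, rfl⟩ := IsLocalizedModule.mk'_surjective P.primeCompl f x
  rw [Function.uncurry_apply_pair] at hx ⊢
  rw [algebraMap_smul, ← IsLocalizedModule.mk'_smul, IsLocalizedModule.mk'_eq_zero'] at hx
  obtain ⟨u, hu⟩ := hx
  refine (Submodule.mem_localized' L P.primeCompl f _ _).mpr ⟨u • m, ?_, u * s, ?_⟩
  · refine (mem_powTorsion_iff b _).mpr ⟨1, ?_⟩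
    rw [pow_one, smul_comm]
    exact hu
  · rw [IsLocalizedModule.mk'_cancel_left]

end Localized

/-- If `Fit_r(N_𝔭) = (a)` at a prime `𝔭` of `R'` (`N = R' ⊗_R B`), then
`Fit_r(N/(a-power torsion)) ⊄ 𝔭`: the localisation of `N/(a-power torsion)` at `𝔭` is a
quotient of `N_𝔭/{x ∣ a x = 0}`, generated by `r` elements by Stacks 080Z; and Stacks 07ZC.
[cite: StacksProject, Tag 0810 (proof, Step 8)] -/
theorem not_fittingIdeal_strictTransform_le [Module.Finite R B] {r : ℕ} {a : R} (P : Ideal R')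
    [P.IsPrime]
    (hFit : Module.fittingIdeal (Localization.AtPrime P)
      (LocalizedModule P.primeCompl (R' ⊗[R] B)) r =
        Ideal.span {algebraMap R' (Localization.AtPrime P) (algebraMap R R' a)}) :
    ¬ Module.fittingIdeal R' ((R' ⊗[R] B) ⧸ (⨆ n : ℕ, Submodule.torsionBy R' (R' ⊗[R] B)
      (algebraMap R R' a ^ n))) r ≤ P := by
  haveI : Module.Finite (Localization.AtPrime P) (LocalizedModule P.primeCompl (R' ⊗[R] B)) :=
    Module.Finite.of_isLocalizedModule P.primeCompl
      (LocalizedModule.mkLinearMap P.primeCompl (R' ⊗[R] B))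
  -- `N_𝔭 / {x | a x = 0}` is generated by `r` elements (Stacks 080Z), hence so is
  -- `N_𝔭 / T_𝔭 ≅ (N / T)_𝔭`, `T` the `a`-power torsion
  have h080Z := Module.exists_span_eq_top_quotient_torsionBy hFit
  have hle' := torsionBy_localized_le (N := R' ⊗[R] B)
    (Nₚ := LocalizedModule P.primeCompl (R' ⊗[R] B)) (algebraMap R R' a) P
    (Localization.AtPrime P) (LocalizedModule.mkLinearMap P.primeCompl (R' ⊗[R] B))
  obtain ⟨y₁, hy₁⟩ := exists_span_eq_top_quotient_of_le hle' h080Z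
  let e := localizedQuotientEquiv P.primeCompl
    (⨆ n : ℕ, Submodule.torsionBy R' (R' ⊗[R] B) (algebraMap R R' a ^ n))
  have hy : Submodule.span (Localization.AtPrime P) (Set.range (e ∘ y₁)) = ⊤ := by
    rw [Set.range_comp, show (⇑e '' Set.range y₁) = ⇑e.toLinearMap '' Set.range y₁ from rfl,
      Submodule.span_image, hy₁, Submodule.map_top, LinearEquiv.range]
  intro hle
  obtain ⟨d, hd, hdP⟩ := Module.exists_mem_fittingIdeal_notMem P (Localization.AtPrime P)
    (LocalizedModule.mkLinearMap P.primeCompl ((R' ⊗[R] B) ⧸ (⨆ n : ℕ,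
      Submodule.torsionBy R' (R' ⊗[R] B) (algebraMap R R' a ^ n)))) (e ∘ y₁) hy
  exact hdP (hle hd)

/-- **The top Fitting ideal of the strict transform is everything**: with `N = R' ⊗_R B`,
`Fit_r(B) = I` and `I R' = (a)`, `Fit_r(N/(a-power torsion)) = R'` — at a maximal ideal `𝔪`,
`Fit_r(N_𝔪) = (a)` over the local ring `R'_𝔪` (Fitting ideals commute with base change and
localisation), and `not_fittingIdeal_strictTransform_le`. [cite: StacksProject, Tag 0810 (proof, Step 8)] -/
theorem fittingIdeal_strictTransform_eq_top [Module.Finite R B] {r : ℕ} {I : Ideal R}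
    (hI : Module.fittingIdeal R B r = I) {a : R}
    (hIR' : I.map (algebraMap R R') = Ideal.span {algebraMap R R' a}) :
    Module.fittingIdeal R' ((R' ⊗[R] B) ⧸ (⨆ n : ℕ, Submodule.torsionBy R' (R' ⊗[R] B)
      (algebraMap R R' a ^ n))) r = ⊤ := by
  by_contra hne
  obtain ⟨P, hPmax, hle⟩ := Ideal.exists_le_maximal _ hne
  haveI := hPmax.isPrime
  refine not_fittingIdeal_strictTransform_le P ?_ hle
  rw [Module.fittingIdeal_of_isLocalizedModule P.primeCompl (Localization.AtPrime P)
      (LocalizedModule.mkLinearMap P.primeCompl (R' ⊗[R] B)) r, Module.fittingIdeal_baseChange,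
    hI, hIR', Ideal.map_span, Set.image_singleton]

/-- **The strict transform is locally free of rank `r`** (Raynaud–Gruson 5.4.2): under the
hypotheses above and with `a` a nonzerodivisor of `R'`, for every prime `𝔭` of `R'` every
localisation of `B' = (R' ⊗_R B)/(a-power torsion)` at `𝔭` is a free `R'_𝔭`-module of rank `r`
(`Fit_{<r}(B') = 0`, `Fit_r(B') = R'`, Stacks 07ZD). [cite: RaynaudGruson1971, Première partie 5.4.2] -/
theorem nonempty_basis_localized_strictTransform [Module.Finite R B] {r : ℕ} {I : Ideal R}
    (hI : Module.fittingIdeal R B r = I) {a : R}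
    (htors : ∀ k < r, ∀ x ∈ Module.fittingIdeal R B k, ∃ n : ℕ, a ^ n * x = 0)
    (hIR' : I.map (algebraMap R R') = Ideal.span {algebraMap R R' a})
    (ha : algebraMap R R' a ∈ nonZeroDivisors R') (P : Ideal R') [P.IsPrime]
    (L : Type u) [CommRing L] [Algebra R' L] [IsLocalization.AtPrime L P]
    {M' : Type u} [AddCommGroup M'] [Module R' M'] [Module L M'] [IsScalarTower R' L M']
    (g : ((R' ⊗[R] B) ⧸ (⨆ n : ℕ, Submodule.torsionBy R' (R' ⊗[R] B)
      (algebraMap R R' a ^ n))) →ₗ[R'] M') [IsLocalizedModule P.primeCompl g] :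
    Nonempty (Module.Basis (Fin r) L M') := by
  haveI : IsLocalRing L := IsLocalization.AtPrime.isLocalRing L P
  haveI : Module.Finite L M' := Module.Finite.of_isLocalizedModule P.primeCompl g
  refine Module.nonempty_basis_of_fittingIdeal ?_ fun k hk => ?_
  · rw [Module.fittingIdeal_of_isLocalizedModule P.primeCompl L g r,
      fittingIdeal_strictTransform_eq_top hI hIR', Ideal.map_top]
  · rw [Module.fittingIdeal_of_isLocalizedModule P.primeCompl L g k,
      fittingIdeal_strictTransform_eq_bot (htors k hk) ha, Ideal.map_bot]

/-- **Blowing up the Fitting ideal flattens** (Raynaud–Gruson 5.4.2–5.4.3; Stacks 081R for a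
finite `R`-module over an affine base, chart by chart): under the hypotheses above, the strict
transform `B' = (R' ⊗_R B)/(a-power torsion)` over the chart `R'` is a FLAT `R'`-module (being
finite and locally free of rank `r`). [cite: RaynaudGruson1971, Première partie 5.4.2] -/
theorem flat_strictTransform [Module.Finite R B] {r : ℕ} {I : Ideal R}
    (hI : Module.fittingIdeal R B r = I) {a : R}
    (htors : ∀ k < r, ∀ x ∈ Module.fittingIdeal R B k, ∃ n : ℕ, a ^ n * x = 0)
    (hIR' : I.map (algebraMap R R') = Ideal.span {algebraMap R R' a})
    (ha : algebraMap R R' a ∈ nonZeroDivisors R') :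
    Module.Flat R' ((R' ⊗[R] B) ⧸ (⨆ n : ℕ, Submodule.torsionBy R' (R' ⊗[R] B)
      (algebraMap R R' a ^ n))) := by
  refine Module.flat_of_localized_maximal _ fun P _ => ?_
  obtain ⟨bas⟩ := nonempty_basis_localized_strictTransform hI htors hIR' ha P
    (Localization.AtPrime P) (LocalizedModule.mkLinearMap P.primeCompl _)
  haveI : Module.Free (Localization.AtPrime P) (LocalizedModule P.primeCompl
      ((R' ⊗[R] B) ⧸ (⨆ n : ℕ, Submodule.torsionBy R' (R' ⊗[R] B) (algebraMap R R' a ^ n)))) :=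
    Module.Free.of_basis bas
  exact (Module.flat_iff_of_isLocalization (Localization.AtPrime P) P.primeCompl _).mp
    inferInstance

end Literature.AlgebraicGeometry.Resolution
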